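import Mathlib
import HarnessLib
import Summits.HubbardSuperconductivity.HubbardSuperconductivity.Theorems.KLProgrammeKLRegimeTwoPointAssemblyGrassmannRepr
import Summits.HubbardSuperconductivity.HubbardSuperconductivity.Theorems.KLProgrammeKLRegimeTwoPointAssemblyDefs

/-!
# Child 4 `KLRegimeTwoPointAssembly` (stmt-HubbardSuperconductivity-19637), stub `stub_asm_repr`:
# the countertermed two-point expectation = `Z_K ·` (free CT two-point function + `C^K`-dressed two-leg coefficient of the
# fully integrated CT action)

The registered stub of the skeleton `Lines/asm-repr` (lead hubbard-kl-r2d-p2), by the generic identity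
`gaussExpect_gen_mul_gen_mul_grassmannExp_neg` (`KLProgrammeKLRegimeTwoPointAssemblyGrassmannRepr`) extended bilinearly to
the position–time fields, with `V_K = V + 𝒩_K` even and without constant part.  Objects from `…TwoPointAssemblyDefs`.
-/

noncomputable section

namespace Summit.HubbardSuperconductivity.HubbardSuperconductivity.Theorems.TwoPointAssembly

set_option linter.dupNamespace false -- summit = problem name (single-conjunct summit), D-0017

open Real Finset Filter Topology Literature.MathematicalPhysics.QuantumLattice Literature.Probability.LatticeModels
open GrassmannAlgebra

/-! ## §1 Parity of the countertermed interaction -/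

section Parity

variable (L M : ℕ) [NeZero L]

/-- The Hubbard vertex is even. -/
theorem hubbardInteraction_mem_evenOdd_zero (β U : ℝ) : hubbardInteraction L M β U ∈ evenOdd ℂ 0 := by
  rw [hubbardInteraction]
  refine Submodule.smul_mem _ _ (Submodule.sum_mem _ fun k₁ _ => Submodule.sum_mem _ fun k₂ _ =>
    Submodule.sum_mem _ fun k₃ _ => Submodule.sum_mem _ fun k₄ _ => ?_)
  split_ifs
  · rw [mul_assoc]
    exact mul_mem_evenOdd_zero ℂ (gen_mul_gen_mem_evenOdd_zero ℂ _ _) (gen_mul_gen_mem_evenOdd_zero ℂ _ _)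
  · exact zero_mem _

/-- The counterterm vertex is even. -/
theorem counterQuadratic_mem_evenOdd_zero (β : ℝ) (K : TrigPolyC4v) : counterQuadratic L M β K ∈ evenOdd ℂ 0 := by
  rw [counterQuadratic]
  exact Submodule.sum_mem _ fun k _ => Submodule.sum_mem _ fun σ _ =>
    Submodule.smul_mem _ _ (gen_mul_gen_mem_evenOdd_zero ℂ _ _)

/-- `V_K` is even. -/
theorem hubbardInteractionCT_mem_evenOdd_zero (β U : ℝ) (K : TrigPolyC4v) :
    hubbardInteractionCT L M β U K ∈ evenOdd ℂ 0 := by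
  rw [hubbardInteractionCT]
  exact add_mem (hubbardInteraction_mem_evenOdd_zero L M β U) (counterQuadratic_mem_evenOdd_zero L M β K)

end Parity

/-! ## §2 The stub -/

section Repr

variable (L M : ℕ) [NeZero L]

/-- **`stub_asm_repr`** (registered signature): when `Z_K ≠ 0`, the un-normalised CT two-point expectation is
`Z_K · R^K_{L,M}`. -/
theorem stub_asm_repr : ∀ (L M : ℕ) [NeZero L] (β U μ : ℝ) (K : TrigPolyC4v) (σ σ' : Fin 2) (xe ye : TorusSite 2 L),
    effPartitionFn ℂ (hubbardCovarianceCT L M β μ 0 K) (hubbardInteractionCT L M β U K) ≠ 0 →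
      gaussExpect ℂ (hubbardCovarianceCT L M β μ 0 K)
          (twoPointInsertion L M β σ σ' xe ye * grassmannExp (-(hubbardInteractionCT L M β U K))) =
        effPartitionFn ℂ (hubbardCovarianceCT L M β μ 0 K) (hubbardInteractionCT L M β U K) *
          twoPointReprCT L M β U μ K σ σ' xe ye := by
  intro L M _ β U μ K σ σ' xe ye hZ
  have hZu : IsUnit (effPartitionFn ℂ (hubbardCovarianceCT L M β μ 0 K) (hubbardInteractionCT L M β U K)) :=
    isUnit_iff_ne_zero.2 hZ
  have hgen := fun a b => gaussExpect_gen_mul_gen_mul_grassmannExp_neg ℂ (hubbardCovarianceCT L M β μ 0 K)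
    (hubbardInteractionCT_mem_evenOdd_zero L M β U K) (constPart_hubbardInteractionCT L M β U K) hZu a b
  rw [twoPointInsertion, positionField_zero_eq_sum, positionField_zero_eq_sum, Finset.sum_mul, Finset.sum_mul, map_sum,
    twoPointReprCT, Finset.mul_sum]
  refine Finset.sum_congr rfl fun k _ => ?_
  rw [Finset.mul_sum, Finset.sum_mul, map_sum, Finset.mul_sum]
  refine Finset.sum_congr rfl fun k' _ => ?_
  rw [smul_mul_smul_comm, smul_mul_assoc, map_smul, hgen, smul_eq_mul, fullActionCT]
  ring

end Repr

end Summit.HubbardSuperconductivity.HubbardSuperconductivity.Theorems.TwoPointAssembly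

end
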